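import Summits.BirchSwinnertonDyer.BirchSwinnertonDyer.Theorems.SignedLowerHalvesKobayashiMainConjectureSmallImageUnitPartnerRecordsA
import Summits.BirchSwinnertonDyer.BirchSwinnertonDyer.Theorems.Rank1ResidualX11RankOneReduction
import Summits.BirchSwinnertonDyer.Rank1Residual.Supersingular.NonsplitCartanThreeDescentRecordsX7Three01
import Summits.BirchSwinnertonDyer.Rank1Residual.Supersingular.NonsplitCartanThreeDescentRecordsX7Three02
import Summits.BirchSwinnertonDyer.Rank1Residual.Supersingular.NonsplitCartanThreeDescentRecordsX7Three07
import Summits.BirchSwinnertonDyer.Rank1Residual.Supersingular.NonsplitCartanDescentRecords07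
import Literature.NumberTheory.EllipticCurves.Fisher2012.HesseFamilyThreeCongruenceProofs
import Literature.NumberTheory.EllipticCurves.Fisher2012.HesseFamilyThreeReverseProofs
import Literature.NumberTheory.EllipticCurves.ComplexMultiplicationLocalFactorsAux
import Literature.NumberTheory.EllipticCurves.PointCountEulerCriterion
import HarnessLib

/-!
# Route `SignedLowerHalves`, crux `KobayashiMainConjectureSmallImage` (item stmt-BirchSwinnertonDyer-19002) —
# L4-UP per-pair records, file B (2 unit-partnered pairs @ 3 + the 2 unit-zone pairs) — Kobayashi's ± main conjecture for rank-0 CM-PARTNERLESS non-surjective pairs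
# from PUBLISHED named facts + displayed certificates — NO preprint, NO CM partner
# (cell `bsd-ssimc`, seat `bsd-ssimc-k3-c4` gen 5, object «L4-UP»; `--supports … --as helper`)

HONEST FRAMING: Kobayashi's signed main conjecture at a non-surjective (normaliser-of-non-split-Cartan)
image is OPEN as a class statement; item 4 stays OPEN; nothing here is booked; BSD is not proved by any
of this. These are PER-PAIR theorems for 7 of the 57 window pairs of item 4 that have NO CM elliptic-curve
partner (the W4 list of the seat's MEMO-3/MEMO-4; none of them has an L4-CM / L4-PUB record):

* FIVE pairs at `p = 3` — `4165m1`, `20335g1`, `117355j1`, `158711b1`, `421645e1` (all with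
  `3 ∣ ∏_ℓ c_ℓ(E)`, so outside the unit zone) — by the UNIT PARTNER `A = 8477b1`
  (Cremona `[1, -1, 0, -338, 1357]`, `N = 7²·173`, rank `0`, `#A(ℚ)_tors = 1`, `∏_ℓ c_ℓ(A) = 2`,
  `#Ш_an(A) = 1`): `E[3] ≃ A[3]` `Γ_ℚ`-equivariantly by a kernel-checked Fisher Hesse-pencil identity
  (`threeCongruent_of_hesseCertificate_unconditional` / `…dualHesseCertificate_unconditional`,
  `norm_num`), `#Sel^(3)(A/ℚ) = 1` (displayed binder `hSelA`: the EXACT two-engine `3`-descent line of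
  the b2b lane — table `HOME(b2b)/b2b-bsdres-additive-p3/g18/desc3nnSS/SS3-3NN-TABLE.md` sha16
  `7891a59bc3297c84`, row `8477b1`: `S = {3, 7, 173}`, `Cl(A) = [1, []]` certified (`bnfcertify = 1`),
  `dim H¹(ℚ,A[3];S) = 2`, **`dim Sel³(A/ℚ) = 0`** mode `EXACT(bnfcertify1+3sat)`, kit j131308; engine 2
  x11c `descentPlib.gp` FULL mode kit j131426: `0 [EXACT] AGREE`), `3 ∤ ∏_ℓ c_ℓ(A) = 2` (displayed binder
  `htamA`, Cremona `allbsd` row `8477 b 1`). Mechanism (class theorem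
  `kobayashiMainConjecture_of_unitPartner_of_bsdp_of_analyticRank_eq_zero`, file
  `…SmallImageMuTransferUnitPartner.lean`): B. D. Kim 2013 Cor. 3.15 makes `ξ^±(A)(0)` a `3`-adic unit,
  so `μ(X^±(A)) = 0`; B. D. Kim 2009 Cor. 2.13 transfers `μ = 0` along `E[3] ≃ A[3]`; then Kobayashi's
  RATIONAL Kato divisibility is integral (Gauss' lemma in `Λ`) and, with `r_an = 0` and `BSD(E,3)` (the
  tree's flag-free exact-descent theorem `bsdp3_nn<label>`, binders `hr`, `hs`/`hvs`, `hSel` passed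
  through and DISPLAYED), the constant-term squeeze gives the EQUALITY for BOTH signs.
* TWO pairs in the UNIT ZONE (`p ∤ ∏_ℓ c_ℓ(E) · #Ш_an(E)`), degenerate partner `A = E`:
  `126350bb1 @ 3` (`∏c = 16`, `#Ш_an = 4`; EXACT descent line of `bsdp3_nn126350bb1`) and
  `431433g1 @ 5` (`∏c = 2`, `#Ш_an = 1`; descent line of `bsdp_s431433g1`, which is **GRH-graded** for
  the class group of the degree-24 field — flag DISPLAYED, as in that theorem), by
  `kobayashiMainConjecture_of_selmerTrivial_of_bsdp_of_analyticRank_eq_zero` (B. D. Kim 2013 on `E`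
  itself; no congruence, no B. D. Kim 2009). The unit-zone locus was identified by seat gen 0
  (`smallImage_kobayashiMainConjecture_of_units_of_bsdp_of_analyticRank_eq_zero`); these two records
  are its per-pair instances on the partnerless list.

Non-kernel inputs per pair, all displayed: Cremona's `r_an = 0` and `#Ш_an` of `E`, the descent line(s),
Cremona's `∏_ℓ c_ℓ` of the partner (resp. of `E`). PUBLISHED named facts consumed BY NAME: B. D. Kim
2009 Cor. 2.13 (`h09`), Kobayashi 2003 Thm. 1.2 / Thm. 4.1 RATIONAL (`h12`, `h41`), B. D. Kim 2013
Cor. 3.15 (`hKim`), the period-unit facts (`h5`, `h3`), GZK (`hGZK`), modularity (`hmod'`). NO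
Pollack–Rubin, NO Pollack `L_p^±` of a partner, NO modular parametrisation, NO `μ`-certificate, NO
preprint binder.

PARTITION (cell bsd-ssimc): X7 (A7) × 7 of item 4's 57 CM-partnerless pairs (5 unit-partnered @ 3 +
2 unit-zone) — types-the-object-of (per-pair kernel records at the «published + certificates» tier);
closes NONE. The other 50 partnerless pairs (35 r0 + 2 r1 @ 3 with no unit partner of conductor
`< 5·10⁵`; 6 @ 5; 3 @ 7; 4 @ 11) are the typed remainder of the seat's MEMO-5.

References: [BDKim2009] Cor. 2.13; [BDKim2013] Cor. 3.15; [Kobayashi2003] Thm. 1.2, Thm. 4.1,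
Conjecture (p. 2); [Fisher2012Hessian] Thm. 13.2 and §13; [Cremona2006]; [Miller2011LMS] Def. 1.1;
[SchaeferStoll2004] (the descent certificates, via the cited tree theorems).
-/

set_option autoImplicit false
set_option linter.dupNamespace false

noncomputable section

open scoped Classical MatrixGroups ModularForm

open CongruenceSubgroup WeierstrassCurve Literature.NumberTheory.EllipticCurves
  Literature.NumberTheory.EllipticCurves.ModularForms
  Literature.NumberTheory.EllipticCurves.Kobayashi2003 ZpExtension
  Literature.NumberTheory.EllipticCurves.GreenbergVatsal2000
  Literature.NumberTheory.EllipticCurves.BDKim2009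
  Literature.NumberTheory.EllipticCurves.Rank1Residual
  Literature.NumberTheory.EllipticCurves.Rank1Residual.Typed
  Literature.NumberTheory.EllipticCurves.Rank1Residual.X11RankOneCertificates
  Literature.NumberTheory.EllipticCurves.Fisher2012
  Summit.BirchSwinnertonDyer.BirchSwinnertonDyer.Rank1Residual.IntModel
  Summit.BirchSwinnertonDyer.BirchSwinnertonDyer.Rank1Residual.X11RankOne
  Summit.BirchSwinnertonDyer.Rank1Residual.X11b
  Summit.BirchSwinnertonDyer.Rank1Residual.Supersingular

namespace Summit.BirchSwinnertonDyer.BirchSwinnertonDyer.Theorems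

/-! ### §1 Kernel point counts at `p` (`a_p = 0`) — file B (the partner's count `card_u8477b1_3` is in file A) -/

/-- `#{Ẽ(𝔽_3)} = 4` for the Cremona model of `158711b1` = `[1, -1, 0, -232717, 2826984]` (`a_3 = 0`: good SUPERSINGULAR; kernel count). [cite: Cremona2006, Table 1 (Cremona label 158711b1)] -/
theorem card_u158711b1_3 :
    Nat.card (((⟨1, -1, 0, -232717, 2826984⟩ : WeierstrassCurve ℤ).map
      (Int.castRingHom (ZMod 3))).toAffine.Point) = 4 := by
  rw [@WeierstrassCurve.natCard_point_eq_one_add_card (ZMod 3) (@ZMod.instField 3 ⟨by norm_num⟩) _ _ _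
    (by decide +kernel), @card_sol_eq_sum_euler (ZMod 3) (@ZMod.instField 3 ⟨by norm_num⟩) _ _
    (by rw [ZMod.ringChar_zmod_n]; decide), ZMod.card]
  decide +kernel
/-- `#{Ẽ(𝔽_3)} = 4` for the Cremona model of `421645e1` = `[1, -1, 0, -456519044, 3754602721183]` (`a_3 = 0`: good SUPERSINGULAR; kernel count). [cite: Cremona2006, Table 1 (Cremona label 421645e1)] -/
theorem card_u421645e1_3 :
    Nat.card (((⟨1, -1, 0, -456519044, 3754602721183⟩ : WeierstrassCurve ℤ).map
      (Int.castRingHom (ZMod 3))).toAffine.Point) = 4 := by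
  rw [@WeierstrassCurve.natCard_point_eq_one_add_card (ZMod 3) (@ZMod.instField 3 ⟨by norm_num⟩) _ _ _
    (by decide +kernel), @card_sol_eq_sum_euler (ZMod 3) (@ZMod.instField 3 ⟨by norm_num⟩) _ _
    (by rw [ZMod.ringChar_zmod_n]; decide), ZMod.card]
  decide +kernel
/-- `#{Ẽ(𝔽_3)} = 4` for the Cremona model of `126350bb1` = `[1, -1, 0, 37233653, 420287217861]` (`a_3 = 0`: good SUPERSINGULAR; kernel count). [cite: Cremona2006, Table 1 (Cremona label 126350bb1)] -/
theorem card_u126350bb1_3 :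
    Nat.card (((⟨1, -1, 0, 37233653, 420287217861⟩ : WeierstrassCurve ℤ).map
      (Int.castRingHom (ZMod 3))).toAffine.Point) = 4 := by
  rw [@WeierstrassCurve.natCard_point_eq_one_add_card (ZMod 3) (@ZMod.instField 3 ⟨by norm_num⟩) _ _ _
    (by decide +kernel), @card_sol_eq_sum_euler (ZMod 3) (@ZMod.instField 3 ⟨by norm_num⟩) _ _
    (by rw [ZMod.ringChar_zmod_n]; decide), ZMod.card]
  decide +kernel
/-- `#{Ẽ(𝔽_5)} = 6` for the Cremona model of `431433g1` = `[1, -1, 1, -471218345, 3937262980886]` (`a_5 = 0`: good SUPERSINGULAR; kernel count). [cite: Cremona2006, Table 1 (Cremona label 431433g1)] -/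
theorem card_u431433g1_5 :
    Nat.card (((⟨1, -1, 1, -471218345, 3937262980886⟩ : WeierstrassCurve ℤ).map
      (Int.castRingHom (ZMod 5))).toAffine.Point) = 6 := by
  rw [@WeierstrassCurve.natCard_point_eq_one_add_card (ZMod 5) (@ZMod.instField 5 ⟨by norm_num⟩) _ _ _
    (by decide +kernel), @card_sol_eq_sum_euler (ZMod 5) (@ZMod.instField 5 ⟨by norm_num⟩) _ _
    (by rw [ZMod.ringChar_zmod_n]; decide), ZMod.card]
  decide +kernel
/-! ### §2 Unit-partnered pairs (file B: 2 of 5) at `p = 3` (partner `A = 8477b1`) -/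

/-- **Kobayashi's ± main conjecture, BOTH signs, for `158711b1 @ 3`** (Cremona model `[1, -1, 0, -232717, 2826984]`, analytic rank `0`,
`∏_ℓ c_ℓ(E) = 36`, `#Ш_an = 1`; item-4 pair: X7, `a_3 = 0`, image `3Nn`, NO CM elliptic-curve partner) **from PUBLISHED named
facts + displayed certificates via the UNIT PARTNER `A = 8477b1`** (`[1, -1, 0, -338, 1357]`; `∏_ℓ c_ℓ(A) = 2`, `#Ш_an(A) = 1`, rank `0`).
Congruence `E[3] ≃ A[3]` (`Γ_ℚ`-equivariant) as a THEOREM: `E` ≅ the member `(1261 : 33)` of Fisher's DUAL Hesse pencil `X_A^-(3)` (scaling `u = 1/693`; `threeCongruent_of_dualHesseCertificate_unconditional`, Fisher 2012 §13, identity checked by `norm_num`). Partner data DISPLAYED: `hSelA` = the EXACT two-engine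
`3`-descent line `#Sel^(3)(A/ℚ) = 1` (b2b `SS3-3NN-TABLE.md` sha16 `7891a59bc3297c84`, row `8477b1`: `dim Sel³ = 0`, mode
`EXACT(bnfcertify1+3sat)`, kit j131308; engine 2 kit j131426 `0 [EXACT] AGREE`), `htamA` = `3 ∤ ∏_ℓ c_ℓ(A) = 2` (Cremona). The pair's own
`BSD(E,3)` is the tree's flag-free `bsdp3_nn158711b1` (`NonsplitCartanThreeDescentRecordsX7Three02.lean`) through its displayed binders `hr` (`r_an = 0`,
Cremona), `hs`/`hvs` (`#Ш_an`, a `3`-unit), `hSel` (`#Sel^(3)(E/ℚ) = 3^0`, EXACT two-engine `3`-descent). BY NAME: `h09`, `h12`, `h41`, `hKim`,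
`h5`, `h3`, `hGZK`, `hmod'` — all PUBLISHED. Chain: `kobayashiMainConjecture_of_unitPartner_of_bsdp_of_analyticRank_eq_zero` (Kim 2013 on `A` ⟹
`μ(X^±(A)) = 0` ⟹ Kim 2009 ⟹ `μ(X^±(E)) = 0` ⟹ integral Kato divisibility ⟹ constant-term squeeze). NO CM, NO preprint, NO
`μ`-certificate. Per pair; item 4 stays OPEN; nothing booked; BSD is not proved by any of this.
[cite: BDKim2009, Cor. 2.13 (p. 187)] [cite: BDKim2013, Cor. 3.15 (p. 199)] [cite: Kobayashi2003, Thm. 4.1 (p. 8) and Conjecture (p. 2)]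
[cite: Fisher2012Hessian, Thm. 13.2 and §13] [cite: Cremona2006, Table 1 (Cremona labels 158711b1, 8477b1)] -/
theorem kobayashiMainConjecture_u158711b1_3_of_unitPartner_of_bsdp
    (h09 : cor213_signedMu_eq_zero_iff_of_torsionIso)
    (h12 : Kobayashi2003.thm12_signedSelmerDual_finite_torsion)
    (h41 : Kobayashi2003.thm41_signedCharIdeal_divisibility)
    (hKim : BDKim2013.cor315_signedCharValue_rankZero)
    (h5 : realPeriodRat_eq_unit_mul_plusPeriod) (h3 : realPeriodRat_eq_unit_mul_plusPeriod_three)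
    (hGZK : rank_eq_analyticRank_of_analyticRank_le_one) (hmod' : hasEntireLFunction_rat)
    (W A : WeierstrassCurve ℚ) [W.IsElliptic] [W.IsGloballyMinimal] [A.IsElliptic] [A.IsGloballyMinimal]
    [Fact (Nat.Prime 3)] (hW : W = ⟨1, -1, 0, -232717, 2826984⟩) (hA : A = ⟨1, -1, 0, -338, 1357⟩)
    (hSelA : Nat.card (A.selmerGroup (3 : ℤ)) = 1) (htamA : ¬ 3 ∣ A.tamagawaProduct)
    (hr : W.analyticRank = 0) {s : ℚ} (hs : shaAn W = (s : ℂ)) (hvs : padicValRat 3 s = 0)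
    (hSel : Nat.card (W.selmerGroup (3 : ℤ)) = 3 ^ W.analyticRank) (ε : ℤˣ) :
    KobayashiMainConjecture W 3 ε := by
  have hIW : integralModelInt W = ⟨1, -1, 0, -232717, 2826984⟩ :=
    integralModelInt_eq_of_map_eq _ (by rw [hW]; ext <;> simp [WeierstrassCurve.map])
  have hIA : integralModelInt A = ⟨1, -1, 0, -338, 1357⟩ :=
    integralModelInt_eq_of_map_eq _ (by rw [hA]; ext <;> simp [WeierstrassCurve.map])
  have hΔ : (⟨1, -1, 0, -232717, 2826984⟩ : WeierstrassCurve ℤ).Δ = discOf [1, -1, 0, -232717, 2826984] :=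
    intCurve_Δ 1 (-1) 0 (-232717) 2826984
  have hΔA : (⟨1, -1, 0, -338, 1357⟩ : WeierstrassCurve ℤ).Δ = discOf [1, -1, 0, -338, 1357] :=
    intCurve_Δ 1 (-1) 0 (-338) 1357
  have hgood : W.HasGoodReductionAtPrime 3 :=
    hasGoodReductionAtPrime_of_not_dvd W 3 (by rw [minimalDiscriminantInt_eq hIW, hΔ]; decide +kernel)
  have hgoodA : A.HasGoodReductionAtPrime 3 :=
    hasGoodReductionAtPrime_of_not_dvd A 3 (by rw [minimalDiscriminantInt_eq hIA, hΔA]; decide +kernel)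
  have hap : W.frobeniusTrace 3 = 0 := by rw [frobeniusTrace_eq hIW card_u158711b1_3]; norm_num
  have hapA : A.frobeniusTrace 3 = 0 := by rw [frobeniusTrace_eq hIA card_u8477b1_3]; norm_num
  have hc4 : W.c₄ = (11170425 : ℚ) := by
    subst hW; norm_num [WeierstrassCurve.c₄, WeierstrassCurve.b₂, WeierstrassCurve.b₄]
  have hc6 : W.c₆ = (-2392247277 : ℚ) := by
    subst hW; norm_num [WeierstrassCurve.c₆, WeierstrassCurve.b₂, WeierstrassCurve.b₄, WeierstrassCurve.b₆]
  have hc4A : A.c₄ = (16233 : ℚ) := by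
    subst hA; norm_num [WeierstrassCurve.c₄, WeierstrassCurve.b₂, WeierstrassCurve.b₄]
  have hc6A : A.c₆ = (-1099413 : ℚ) := by
    subst hA; norm_num [WeierstrassCurve.c₆, WeierstrassCurve.b₂, WeierstrassCurve.b₄, WeierstrassCurve.b₆]
  -- C1 as a THEOREM: `E` is the member `(1261 : 33)` of the DUAL Hesse pencil `X_A^-(3)` of `A`, scaling `u = 1/693`
  have hiso := threeCongruent_of_dualHesseCertificate_unconditional A W ((1261 : ℚ) / 33) 1 ((1 : ℚ) / 693)
    (by norm_num) (by rw [hc4A, hc6A, hc4, eval_hesseD3]; norm_num)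
    (by rw [hc4A, hc6A, hc6, eval_hesseC6three]; norm_num)
  exact kobayashiMainConjecture_of_unitPartner_of_bsdp_of_analyticRank_eq_zero W A 3 h09 h12 h41 hKim h5 h3
    hGZK hmod' (by norm_num) hgood hap hgoodA hapA hiso hSelA htamA hr
    (bsdp3_nn158711b1 hGZK W hW (hr.trans_le zero_le_one) hs hvs hSel) ε

/-- **Kobayashi's ± main conjecture, BOTH signs, for `421645e1 @ 3`** (Cremona model `[1, -1, 0, -456519044, 3754602721183]`, analytic rank `0`,
`∏_ℓ c_ℓ(E) = 54`, `#Ш_an = 1`; item-4 pair: X7, `a_3 = 0`, image `3Nn`, NO CM elliptic-curve partner) **from PUBLISHED named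
facts + displayed certificates via the UNIT PARTNER `A = 8477b1`** (`[1, -1, 0, -338, 1357]`; `∏_ℓ c_ℓ(A) = 2`, `#Ш_an(A) = 1`, rank `0`).
Congruence `E[3] ≃ A[3]` (`Γ_ℚ`-equivariant) as a THEOREM: `E` ≅ the member `(-9191 : 27)` of Fisher's Hesse pencil `X_A(3)` (scaling `u = 346/27`; `threeCongruent_of_hesseCertificate_unconditional`, Fisher 2012 Thm. 13.2, identity checked by `norm_num`). Partner data DISPLAYED: `hSelA` = the EXACT two-engine
`3`-descent line `#Sel^(3)(A/ℚ) = 1` (b2b `SS3-3NN-TABLE.md` sha16 `7891a59bc3297c84`, row `8477b1`: `dim Sel³ = 0`, mode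
`EXACT(bnfcertify1+3sat)`, kit j131308; engine 2 kit j131426 `0 [EXACT] AGREE`), `htamA` = `3 ∤ ∏_ℓ c_ℓ(A) = 2` (Cremona). The pair's own
`BSD(E,3)` is the tree's flag-free `bsdp3_nn421645e1` (`NonsplitCartanThreeDescentRecordsX7Three07.lean`) through its displayed binders `hr` (`r_an = 0`,
Cremona), `hs`/`hvs` (`#Ш_an`, a `3`-unit), `hSel` (`#Sel^(3)(E/ℚ) = 3^0`, EXACT two-engine `3`-descent). BY NAME: `h09`, `h12`, `h41`, `hKim`,
`h5`, `h3`, `hGZK`, `hmod'` — all PUBLISHED. Chain: `kobayashiMainConjecture_of_unitPartner_of_bsdp_of_analyticRank_eq_zero` (Kim 2013 on `A` ⟹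
`μ(X^±(A)) = 0` ⟹ Kim 2009 ⟹ `μ(X^±(E)) = 0` ⟹ integral Kato divisibility ⟹ constant-term squeeze). NO CM, NO preprint, NO
`μ`-certificate. Per pair; item 4 stays OPEN; nothing booked; BSD is not proved by any of this.
[cite: BDKim2009, Cor. 2.13 (p. 187)] [cite: BDKim2013, Cor. 3.15 (p. 199)] [cite: Kobayashi2003, Thm. 4.1 (p. 8) and Conjecture (p. 2)]
[cite: Fisher2012Hessian, Thm. 13.2 and §13] [cite: Cremona2006, Table 1 (Cremona labels 421645e1, 8477b1)] -/
theorem kobayashiMainConjecture_u421645e1_3_of_unitPartner_of_bsdp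
    (h09 : cor213_signedMu_eq_zero_iff_of_torsionIso)
    (h12 : Kobayashi2003.thm12_signedSelmerDual_finite_torsion)
    (h41 : Kobayashi2003.thm41_signedCharIdeal_divisibility)
    (hKim : BDKim2013.cor315_signedCharValue_rankZero)
    (h5 : realPeriodRat_eq_unit_mul_plusPeriod) (h3 : realPeriodRat_eq_unit_mul_plusPeriod_three)
    (hGZK : rank_eq_analyticRank_of_analyticRank_le_one) (hmod' : hasEntireLFunction_rat)
    (W A : WeierstrassCurve ℚ) [W.IsElliptic] [W.IsGloballyMinimal] [A.IsElliptic] [A.IsGloballyMinimal]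
    [Fact (Nat.Prime 3)] (hW : W = ⟨1, -1, 0, -456519044, 3754602721183⟩) (hA : A = ⟨1, -1, 0, -338, 1357⟩)
    (hSelA : Nat.card (A.selmerGroup (3 : ℤ)) = 1) (htamA : ¬ 3 ∣ A.tamagawaProduct)
    (hr : W.analyticRank = 0) {s : ℚ} (hs : shaAn W = (s : ℂ)) (hvs : padicValRat 3 s = 0)
    (hSel : Nat.card (W.selmerGroup (3 : ℤ)) = 3 ^ W.analyticRank) (ε : ℤˣ) :
    KobayashiMainConjecture W 3 ε := by
  have hIW : integralModelInt W = ⟨1, -1, 0, -456519044, 3754602721183⟩ :=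
    integralModelInt_eq_of_map_eq _ (by rw [hW]; ext <;> simp [WeierstrassCurve.map])
  have hIA : integralModelInt A = ⟨1, -1, 0, -338, 1357⟩ :=
    integralModelInt_eq_of_map_eq _ (by rw [hA]; ext <;> simp [WeierstrassCurve.map])
  have hΔ : (⟨1, -1, 0, -456519044, 3754602721183⟩ : WeierstrassCurve ℤ).Δ = discOf [1, -1, 0, -456519044, 3754602721183] :=
    intCurve_Δ 1 (-1) 0 (-456519044) 3754602721183
  have hΔA : (⟨1, -1, 0, -338, 1357⟩ : WeierstrassCurve ℤ).Δ = discOf [1, -1, 0, -338, 1357] :=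
    intCurve_Δ 1 (-1) 0 (-338) 1357
  have hgood : W.HasGoodReductionAtPrime 3 :=
    hasGoodReductionAtPrime_of_not_dvd W 3 (by rw [minimalDiscriminantInt_eq hIW, hΔ]; decide +kernel)
  have hgoodA : A.HasGoodReductionAtPrime 3 :=
    hasGoodReductionAtPrime_of_not_dvd A 3 (by rw [minimalDiscriminantInt_eq hIA, hΔA]; decide +kernel)
  have hap : W.frobeniusTrace 3 = 0 := by rw [frobeniusTrace_eq hIW card_u421645e1_3]; norm_num
  have hapA : A.frobeniusTrace 3 = 0 := by rw [frobeniusTrace_eq hIA card_u8477b1_3]; norm_num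
  have hc4 : W.c₄ = (21912914121 : ℚ) := by
    subst hW; norm_num [WeierstrassCurve.c₄, WeierstrassCurve.b₂, WeierstrassCurve.b₄]
  have hc6 : W.c₆ = (-3243878142988581 : ℚ) := by
    subst hW; norm_num [WeierstrassCurve.c₆, WeierstrassCurve.b₂, WeierstrassCurve.b₄, WeierstrassCurve.b₆]
  have hc4A : A.c₄ = (16233 : ℚ) := by
    subst hA; norm_num [WeierstrassCurve.c₄, WeierstrassCurve.b₂, WeierstrassCurve.b₄]
  have hc6A : A.c₆ = (-1099413 : ℚ) := by
    subst hA; norm_num [WeierstrassCurve.c₆, WeierstrassCurve.b₂, WeierstrassCurve.b₄, WeierstrassCurve.b₆]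
  -- C1 as a THEOREM: `E` is the member `(-9191 : 27)` of the Hesse pencil `X_A(3)` of `A`, scaling `u = 346/27`
  have hiso := threeCongruent_of_hesseCertificate_unconditional A W ((-9191 : ℚ) / 27) 1 ((346 : ℚ) / 27)
    (by norm_num) (by rw [hc4A, hc6A, hc4, eval_hesseC4three]; norm_num)
    (by rw [hc4A, hc6A, hc6, eval_hesseC6three]; norm_num)
  exact kobayashiMainConjecture_of_unitPartner_of_bsdp_of_analyticRank_eq_zero W A 3 h09 h12 h41 hKim h5 h3
    hGZK hmod' (by norm_num) hgood hap hgoodA hapA hiso hSelA htamA hr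
    (bsdp3_nn421645e1 hGZK W hW (hr.trans_le zero_le_one) hs hvs hSel) ε

/-! ### §3 Two unit-zone pairs (degenerate partner `A = E`): `126350bb1 @ 3`, `431433g1 @ 5` -/

/-- **Kobayashi's ± main conjecture, BOTH signs, for `126350bb1 @ 3`** (Cremona model `[1, -1, 0, 37233653, 420287217861]`, analytic rank `0`,
`∏_ℓ c_ℓ(E) = 16`, `#Ш_an = 4`; item-4 pair: X7, `a_3 = 0`, image `3Nn`, NO CM elliptic-curve partner) — the UNIT ZONE
(`3 ∤ ∏_ℓ c_ℓ(E)·#Ш_an(E)`), **from PUBLISHED named facts + the pair's OWN descent line, NO partner at all**: B. D. Kim 2013 Cor. 3.15 on `E`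
itself makes `ξ^±(E)(0)` a `3`-adic unit (`#Sel^(3)(E/ℚ) = 1` ⟹ `#Sel_{3^∞}(E/ℚ) = 1`; `3 ∤ ∏c_ℓ`), so `μ(X^±(E)) = 0`, and the rank-`0`
converse with `BSD(E,3)` concludes (`kobayashiMainConjecture_of_selmerTrivial_of_bsdp_of_analyticRank_eq_zero`; locus = seat gen 0's
`smallImage_kobayashiMainConjecture_of_units_of_bsdp_of_analyticRank_eq_zero`). Displayed per-pair inputs: `hr` (`r_an = 0`, Cremona), `hs`/`hvs`
(`#Ш_an = 4`), `htam` (`3 ∤ ∏_ℓ c_ℓ(E) = 16`, Cremona), `hSel` (`#Sel^(3)(E/ℚ) = 3^0`: EXACT two-engine `3`-descent (kit j131308 / j131426)) — the SAME line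
feeds `BSD(E,3)` through the tree's flag-free `bsdp3_nn126350bb1` (`NonsplitCartanThreeDescentRecordsX7Three02.lean`). BY NAME: `h12`, `h41`, `hKim`, `h5`, `h3`, `hGZK`, `hmod'`.
NO congruence, NO B. D. Kim 2009, NO preprint. Per pair; item 4 stays OPEN; nothing booked; BSD is not proved by any of this.
[cite: BDKim2013, Cor. 3.15 (p. 199)] [cite: Kobayashi2003, Thm. 4.1 (p. 8) and Conjecture (p. 2)] [cite: Cremona2006, Table 1 (Cremona label 126350bb1)] -/
theorem kobayashiMainConjecture_u126350bb1_3_of_selmerTrivial_of_bsdp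
    (h12 : Kobayashi2003.thm12_signedSelmerDual_finite_torsion)
    (h41 : Kobayashi2003.thm41_signedCharIdeal_divisibility)
    (hKim : BDKim2013.cor315_signedCharValue_rankZero)
    (h5 : realPeriodRat_eq_unit_mul_plusPeriod) (h3 : realPeriodRat_eq_unit_mul_plusPeriod_three)
    (hGZK : rank_eq_analyticRank_of_analyticRank_le_one) (hmod' : hasEntireLFunction_rat)
    (W : WeierstrassCurve ℚ) [W.IsElliptic] [W.IsGloballyMinimal] [Fact (Nat.Prime 3)] (hW : W = ⟨1, -1, 0, 37233653, 420287217861⟩)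
    (htam : ¬ 3 ∣ W.tamagawaProduct)
    (hr : W.analyticRank = 0) {s : ℚ} (hs : shaAn W = (s : ℂ)) (hvs : padicValRat 3 s = 0)
    (hSel : Nat.card (W.selmerGroup (3 : ℤ)) = 3 ^ W.analyticRank) (ε : ℤˣ) :
    KobayashiMainConjecture W 3 ε := by
  have hIW : integralModelInt W = ⟨1, -1, 0, 37233653, 420287217861⟩ :=
    integralModelInt_eq_of_map_eq _ (by rw [hW]; ext <;> simp [WeierstrassCurve.map])
  have hΔ : (⟨1, -1, 0, 37233653, 420287217861⟩ : WeierstrassCurve ℤ).Δ = discOf [1, -1, 0, 37233653, 420287217861] :=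
    intCurve_Δ 1 (-1) 0 37233653 420287217861
  have hgood : W.HasGoodReductionAtPrime 3 :=
    hasGoodReductionAtPrime_of_not_dvd W 3 (by rw [minimalDiscriminantInt_eq hIW, hΔ]; decide +kernel)
  have hap : W.frobeniusTrace 3 = 0 := by rw [frobeniusTrace_eq hIW card_u126350bb1_3]; norm_num
  have hSel1 : Nat.card (W.selmerGroup (3 : ℤ)) = 1 := by rw [hSel, hr, pow_zero]
  exact kobayashiMainConjecture_of_selmerTrivial_of_bsdp_of_analyticRank_eq_zero W 3 h12 h41 hKim h5 h3 hGZK hmod'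
    (by norm_num) hgood hap hSel1 htam hr (bsdp3_nn126350bb1 hGZK W hW (hr.trans_le zero_le_one) hs hvs hSel) ε

/-- **Kobayashi's ± main conjecture, BOTH signs, for `431433g1 @ 5`** (Cremona model `[1, -1, 1, -471218345, 3937262980886]`, analytic rank `0`,
`∏_ℓ c_ℓ(E) = 2`, `#Ш_an = 1`; item-4 pair: X7, `a_5 = 0`, image `5Nn`, NO CM elliptic-curve partner) — the UNIT ZONE
(`5 ∤ ∏_ℓ c_ℓ(E)·#Ш_an(E)`), **from PUBLISHED named facts + the pair's OWN descent line, NO partner at all**: B. D. Kim 2013 Cor. 3.15 on `E`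
itself makes `ξ^±(E)(0)` a `5`-adic unit (`#Sel^(5)(E/ℚ) = 1` ⟹ `#Sel_{5^∞}(E/ℚ) = 1`; `5 ∤ ∏c_ℓ`), so `μ(X^±(E)) = 0`, and the rank-`0`
converse with `BSD(E,5)` concludes (`kobayashiMainConjecture_of_selmerTrivial_of_bsdp_of_analyticRank_eq_zero`; locus = seat gen 0's
`smallImage_kobayashiMainConjecture_of_units_of_bsdp_of_analyticRank_eq_zero`). Displayed per-pair inputs: `hr` (`r_an = 0`, Cremona), `hs`/`hvs`
(`#Ш_an = 1`), `htam` (`5 ∤ ∏_ℓ c_ℓ(E) = 2`, Cremona), `hSel` (`#Sel^(5)(E/ℚ) = 5^0`: **GRH-graded** full `5`-descent of the x11c lane (class group of the degree-24 field `R` under GRH; flag displayed exactly as in `bsdp_s431433g1`)) — the SAME line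
feeds `BSD(E,5)` through the tree's flag-free `bsdp_s431433g1` (`NonsplitCartanDescentRecords07.lean`). BY NAME: `h12`, `h41`, `hKim`, `h5`, `h3`, `hGZK`, `hmod'`.
NO congruence, NO B. D. Kim 2009, NO preprint. Per pair; item 4 stays OPEN; nothing booked; BSD is not proved by any of this.
[cite: BDKim2013, Cor. 3.15 (p. 199)] [cite: Kobayashi2003, Thm. 4.1 (p. 8) and Conjecture (p. 2)] [cite: Cremona2006, Table 1 (Cremona label 431433g1)] -/
theorem kobayashiMainConjecture_u431433g1_5_of_selmerTrivial_of_bsdp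
    (h12 : Kobayashi2003.thm12_signedSelmerDual_finite_torsion)
    (h41 : Kobayashi2003.thm41_signedCharIdeal_divisibility)
    (hKim : BDKim2013.cor315_signedCharValue_rankZero)
    (h5 : realPeriodRat_eq_unit_mul_plusPeriod) (h3 : realPeriodRat_eq_unit_mul_plusPeriod_three)
    (hGZK : rank_eq_analyticRank_of_analyticRank_le_one) (hmod' : hasEntireLFunction_rat)
    (W : WeierstrassCurve ℚ) [W.IsElliptic] [W.IsGloballyMinimal] [Fact (Nat.Prime 5)] (hW : W = ⟨1, -1, 1, -471218345, 3937262980886⟩)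
    (htam : ¬ 5 ∣ W.tamagawaProduct)
    (hr : W.analyticRank = 0) {s : ℚ} (hs : shaAn W = (s : ℂ)) (hvs : padicValRat 5 s = 0)
    (hSel : Nat.card (W.selmerGroup (5 : ℤ)) = 5 ^ W.analyticRank) (ε : ℤˣ) :
    KobayashiMainConjecture W 5 ε := by
  have hIW : integralModelInt W = ⟨1, -1, 1, -471218345, 3937262980886⟩ :=
    integralModelInt_eq_of_map_eq _ (by rw [hW]; ext <;> simp [WeierstrassCurve.map])
  have hΔ : (⟨1, -1, 1, -471218345, 3937262980886⟩ : WeierstrassCurve ℤ).Δ = discOf [1, -1, 1, -471218345, 3937262980886] :=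
    intCurve_Δ 1 (-1) 1 (-471218345) 3937262980886
  have hgood : W.HasGoodReductionAtPrime 5 :=
    hasGoodReductionAtPrime_of_not_dvd W 5 (by rw [minimalDiscriminantInt_eq hIW, hΔ]; decide +kernel)
  have hap : W.frobeniusTrace 5 = 0 := by rw [frobeniusTrace_eq hIW card_u431433g1_5]; norm_num
  have hSel1 : Nat.card (W.selmerGroup (5 : ℤ)) = 1 := by rw [hSel, hr, pow_zero]
  exact kobayashiMainConjecture_of_selmerTrivial_of_bsdp_of_analyticRank_eq_zero W 5 h12 h41 hKim h5 h3 hGZK hmod'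
    (by norm_num) hgood hap hSel1 htam hr (bsdp_s431433g1 hGZK W hW (hr.trans_le zero_le_one) hs hvs hSel) ε

end Summit.BirchSwinnertonDyer.BirchSwinnertonDyer.Theorems

end
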